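import Summits.QuantumFields.YangMills.Theses.CoarseStiffnessTail
import Summits.QuantumFields.YangMills.Theorems.CoarseStiffnessTailCappedCoarseStiffnessLUnitLatticeStubs
import HarnessLib

/-!
# Skeleton v9 (lead's copy) for crux `CoarseStiffnessTail.CappedCoarseStiffnessL` (stmt-QuantumFields-25301), line `birth`

v9 by g20 (2026-08-29): RESHAPE of v8 (g15) by DEPTH REMOVAL — the two open stubs are restated at the TOP SLICE `j = K` only (one quantifier block
fewer each; no depth `j₀`, no height `j`), through the landed certificate `Theorems/CoarseStiffnessTailCappedCoarseStiffnessLUnitLatticeStubs.lean`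
(g20: `edgeDeep_iff_unitLargeFieldCount`, `bulkDeep_iff_unitSubThresholdStiffness`, `cappedCoarseStiffnessL_iff_unitStubs` — v8's S1 ⇔ S1' and
v8's S2 ⇔ S2' EXACTLY, constants transported; S3 `stub_uniformMeanAction` is CLOSED (g15, `…LUniformMeanAction`) and no longer appears).
The crux (this line's one new obligation, XL):

  `CappedCoarseStiffnessL := ∀ L b₀ p₀, 0 < b₀ → 2 < p₀ → ∃ c₀ C₀ γ₁, 0 < c₀ ∧ 0 < γ₁ ∧ γ₁ ≤ 1 ∧ ∀ F γ, F.L = L → 0 < γ → γ ≤ γ₁ →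
     ∀ K j, j ≤ K → ∫ exp(c₀·β_{K−j}·Σ_a min(|Ū^j(∂a) − 1|², θ(K−j)²)) dGibbs_K ≤ exp(C₀·#Plaq_j)`.

WHY THE RESHAPE.  Run `j + d` of `F` at height `j` and coupling `γ` IS run `j` of the refined family `F.refine d` (volume exponent `m + d`) at its
top level and coupling `γL^{-d}` (same finest lattice, same Wilson weight, block averagings matched level by level: g4's `…LUnitSlice` for the crux,
g20's `integral_exp_plaqFun_eq_refine` for every plaquette functional).  Since the stubs quantify over ALL families with `F.L = L` and ALL `γ ≤ γ₁`,
every height `j < K` and every depth `j₀` is bookkeeping: the open content is about the `K`-fold averaged field on the UNIT lattice (`2L^m` sites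
per direction) at the unit coupling `γ` and window `θ_γ(0) = √γ·p(√γ)`, uniformly in the cut-off `K`, the volume exponent `m` and `γ ≤ γ₁` — nothing else.

* `stub_unitLargeFieldCount` (S1', XL — EDGE AT THE TOP): ONE rate `c₀` such that `∫ exp(c₀·p(√γ)²·N_K) dGibbs_K ≤ e^{C₀·#Plaq_K}` for all
  `(F, γ ≤ γ₁, K)`, `N_K = #{unit plaquettes a : θ_γ(0) ≤ |Ū^K(∂a) − 1|}` — the joint Peierls bound «unit-scale large fields of the fully averaged
  configuration are `e^{−c₀p(g₀)²}`-rare per plaquette», UNIFORMLY IN THE CUT-OFF = [Balaban1985UV3] (71) p.273 at the LAST renormalisation step,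
  summed over large-field sets and integrated against the Gibbs law (multi-scale; every bounded cut-off is g13's theorem).
* `stub_unitSubThresholdStiffness` (S2', XL — BULK AT THE TOP): `∫ exp(c₀·γ⁻¹·Y_K) dGibbs_K ≤ e^{C₀·#Plaq_K}`,
  `Y_K = Σ_a |Ū^K(∂a) − 1|²·1[|Ū^K(∂a) − 1| < θ_γ(0)]` — Gaussian small-field stiffness of the unit-lattice averaged field at its own coupling
  ([Balaban1985UV3] (5) p.256 at two couplings / (70) p.273; every bounded cut-off is g14's theorem given the closed S3).
COMPOSITION `CappedCoarseStiffnessL_of` (sorry-free given the stubs): `CoarseStiffnessTailUnitLatticeStubs.cappedCoarseStiffnessL_of_unitStubs`.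
Nothing registered earlier is lost: v8's S1 ⇔ S1', v8's S2 ⇔ S2' (`edgeDeep_iff_unitLargeFieldCount`, `bulkDeep_iff_unitSubThresholdStiffness`), and
the crux ⇒ S1' ∧ S2' (`unitStubs_of_cappedCoarseStiffnessL`, §3 below): the two stubs are FACTORS of the crux, not strengthenings.

HONEST SCOPE.  A skeleton: the crux is OPEN; no rung, leaf or summit is proved (R3 record rung; `YM3TorusSU2` NOT proved; YM mass gap NOT touched).
-/

noncomputable section

namespace Summit.QuantumFields.YangMills.Cruxes.CappedCoarseStiffnessL.Birth

open MeasureTheory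
open Literature.MathematicalPhysics.QuantumFieldTheory
open Literature.MathematicalPhysics.QuantumFieldTheory.Balaban1983to89
open Literature.MathematicalPhysics.QuantumFieldTheory.Balaban1983to89.T3ContinuumYM3Torus
open Literature.MathematicalPhysics.QuantumFieldTheory.Balaban1983to89.T3UnitScaleTilt
open Literature.MathematicalPhysics.QuantumFieldTheory.Balaban1983to89.T3UnitLawDensityEML
open Summit.QuantumFields.YangMills.Theorems.CoarseStiffnessTailUnitLatticeStubs (cappedCoarseStiffnessL_of_unitStubs unitStubs_of_cappedCoarseStiffnessL)

/-! ## §1 The registered stubs (the ONLY sorries of the file) -/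

/-- STUB S1' (XL — EDGE AT THE TOP SLICE) — **UNIT-LATTICE LARGE-FIELD COUNT, UNIFORMLY IN THE CUT-OFF**: for every `(L, b₀, p₀)` there are
`(c₀, C₀, γ₁)` such that for every `F` (`F.L = L`), `0 < γ ≤ γ₁` and EVERY cut-off `K`:
`∫ exp(c₀·p(√γ)²·#{a ∈ Plaq_K : θ_γ(0) ≤ |Ū^K(∂a) − 1|}) dGibbs_K ≤ exp(C₀·#Plaq_K)` — Bałaban's small factor `e^{−¼p(g₀)²}` per large plaquette of
the FULLY averaged (unit-lattice) field, summed over large-field sets and integrated, uniformly in `K`, `m`, `γ`.  (Equivalent to v8's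
`stub_uniformLargeFieldCountDeep`: `CoarseStiffnessTailUnitLatticeStubs.edgeDeep_iff_unitLargeFieldCount`.) [cite: Balaban1985UV3, (71) p.273] -/
theorem stub_unitLargeFieldCount :
    ∀ (L : ℕ) (b₀ p₀ : ℝ), 0 < b₀ → 2 < p₀ → ∃ (c₀ C₀ γ₁ : ℝ), 0 < c₀ ∧ 0 < γ₁ ∧ γ₁ ≤ 1 ∧
      ∀ (F : T3Family) (γ : ℝ), F.L = L → 0 < γ → γ ≤ γ₁ → ∀ (K : ℕ),
        ∫ U, Real.exp (c₀ * B10.pFun b₀ p₀ (Real.sqrt γ) ^ 2 *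
            ∑ a : Plaq (F.P K) K, (if T3UnitScaleTilt.θBal F.L γ b₀ p₀ 0 ≤ GaugeGroup.dist1 (GaugeField.plaqHol
              (Averaging.iter (fun i => BlockAveraging.blockAvg (P := F.P K) (j := i) T3UnitLawDensityEML.ℰp) K U) a)
              then (1 : ℝ) else 0)) ∂(T3UnitScaleTilt.gibbsK F T3UnitLawDensityEML.ℰp γ K) ≤
          Real.exp (C₀ * (Fintype.card (Plaq (F.P K) K) : ℝ)) := by
  sorry

/-- STUB S2' (XL — BULK AT THE TOP SLICE) — **UNIT-LATTICE SUB-THRESHOLD STIFFNESS, UNIFORMLY IN THE CUT-OFF**: for every `(L, b₀, p₀)` there are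
`(c₀, C₀, γ₁)` such that for every `F` (`F.L = L`), `0 < γ ≤ γ₁` and EVERY cut-off `K`:
`∫ exp(c₀·γ⁻¹·Σ_a |Ū^K(∂a) − 1|²·1[|Ū^K(∂a) − 1| < θ_γ(0)]) dGibbs_K ≤ exp(C₀·#Plaq_K)` — the Gaussian small-field control of the unit-lattice averaged
plaquettes at the unit coupling (Bałaban's (5) at two couplings / (70)).  (Equivalent to v8's `stub_subThresholdStiffnessDeep`:
`CoarseStiffnessTailUnitLatticeStubs.bulkDeep_iff_unitSubThresholdStiffness`.) [cite: Balaban1985UV3, (5) p.256 and (70) p.273] -/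
theorem stub_unitSubThresholdStiffness :
    ∀ (L : ℕ) (b₀ p₀ : ℝ), 0 < b₀ → 2 < p₀ → ∃ (c₀ C₀ γ₁ : ℝ), 0 < c₀ ∧ 0 < γ₁ ∧ γ₁ ≤ 1 ∧
      ∀ (F : T3Family) (γ : ℝ), F.L = L → 0 < γ → γ ≤ γ₁ → ∀ (K : ℕ),
        ∫ U, Real.exp (c₀ * γ⁻¹ *
            ∑ a : Plaq (F.P K) K, (if GaugeGroup.dist1 (GaugeField.plaqHol
              (Averaging.iter (fun i => BlockAveraging.blockAvg (P := F.P K) (j := i) T3UnitLawDensityEML.ℰp) K U) a) <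
                T3UnitScaleTilt.θBal F.L γ b₀ p₀ 0 then
              GaugeGroup.dist1 (GaugeField.plaqHol
                (Averaging.iter (fun i => BlockAveraging.blockAvg (P := F.P K) (j := i) T3UnitLawDensityEML.ℰp) K U) a) ^ 2 else 0))
            ∂(T3UnitScaleTilt.gibbsK F T3UnitLawDensityEML.ℰp γ K) ≤
          Real.exp (C₀ * (Fintype.card (Plaq (F.P K) K) : ℝ)) := by
  sorry

/-! ## §2 The composition (sorry-free given §1) -/

/-- **THE CRUX FROM THE STUBS**: `cappedCoarseStiffnessL_of_unitStubs` (g20: depth removal + g8's exact EDGE/BULK factorisation).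
[cite: Balaban1985UV3, (5) p.256 and (71) p.273] -/
theorem CappedCoarseStiffnessL_of : Summit.QuantumFields.YangMills.Theses.CoarseStiffnessTail.CappedCoarseStiffnessL :=
  cappedCoarseStiffnessL_of_unitStubs stub_unitLargeFieldCount stub_unitSubThresholdStiffness

/-! ## §3 Record: the factorisation is exact (sorry-free remark) -/

/-- **THE CRUX ⇒ S1' ∧ S2'** (`unitStubs_of_cappedCoarseStiffnessL`): the two stubs are FACTORS of the crux, not strengthenings; with
`edgeDeep_iff_unitLargeFieldCount` / `bulkDeep_iff_unitSubThresholdStiffness` nothing registered earlier (v5–v8) is lost. [cite: Balaban1985UV3, (5) p.256 and (71) p.273] -/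
theorem stubs_of_crux (h : Summit.QuantumFields.YangMills.Theses.CoarseStiffnessTail.CappedCoarseStiffnessL) :
    (∀ (L : ℕ) (b₀ p₀ : ℝ), 0 < b₀ → 2 < p₀ → ∃ (c₀ C₀ γ₁ : ℝ), 0 < c₀ ∧ 0 < γ₁ ∧ γ₁ ≤ 1 ∧
      ∀ (F : T3Family) (γ : ℝ), F.L = L → 0 < γ → γ ≤ γ₁ → ∀ (K : ℕ),
        ∫ U, Real.exp (c₀ * B10.pFun b₀ p₀ (Real.sqrt γ) ^ 2 *
            ∑ a : Plaq (F.P K) K, (if T3UnitScaleTilt.θBal F.L γ b₀ p₀ 0 ≤ GaugeGroup.dist1 (GaugeField.plaqHol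
              (Averaging.iter (fun i => BlockAveraging.blockAvg (P := F.P K) (j := i) T3UnitLawDensityEML.ℰp) K U) a)
              then (1 : ℝ) else 0)) ∂(T3UnitScaleTilt.gibbsK F T3UnitLawDensityEML.ℰp γ K) ≤
          Real.exp (C₀ * (Fintype.card (Plaq (F.P K) K) : ℝ))) ∧
    (∀ (L : ℕ) (b₀ p₀ : ℝ), 0 < b₀ → 2 < p₀ → ∃ (c₀ C₀ γ₁ : ℝ), 0 < c₀ ∧ 0 < γ₁ ∧ γ₁ ≤ 1 ∧
      ∀ (F : T3Family) (γ : ℝ), F.L = L → 0 < γ → γ ≤ γ₁ → ∀ (K : ℕ),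
        ∫ U, Real.exp (c₀ * γ⁻¹ *
            ∑ a : Plaq (F.P K) K, (if GaugeGroup.dist1 (GaugeField.plaqHol
              (Averaging.iter (fun i => BlockAveraging.blockAvg (P := F.P K) (j := i) T3UnitLawDensityEML.ℰp) K U) a) <
                T3UnitScaleTilt.θBal F.L γ b₀ p₀ 0 then
              GaugeGroup.dist1 (GaugeField.plaqHol
                (Averaging.iter (fun i => BlockAveraging.blockAvg (P := F.P K) (j := i) T3UnitLawDensityEML.ℰp) K U) a) ^ 2 else 0))
            ∂(T3UnitScaleTilt.gibbsK F T3UnitLawDensityEML.ℰp γ K) ≤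
          Real.exp (C₀ * (Fintype.card (Plaq (F.P K) K) : ℝ))) :=
  unitStubs_of_cappedCoarseStiffnessL h

end Summit.QuantumFields.YangMills.Cruxes.CappedCoarseStiffnessL.Birth

end
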